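import Summits.NavierStokesRegularity.NavierStokesRegularity.Theses.RossbyDichotomy
import Literature.Analysis.FluidPDE.ClassicalSolution
import Literature.Analysis.FluidPDE.LerayHopf
import Literature.Analysis.FluidPDE.VectorCalculus

/-!
# `RossbyDichotomy.HandOverTime` (stmt-NavierStokesRegularity-2922) is false as soon as ONE global
# solution keeps a hyperbolic vorticity maximum forever — negative lemma modulo `EternalHyperbolicMaxSolution`

`--supports stmt-NavierStokesRegularity-2922`, lane `--negative-modulo EternalHyperbolicMaxSolution`
(refuter seat ns-typeII-critic-1, D-0081 §B; re-filing of the gen-8 pair p535037/p535040, which bounced only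
because the hypothesis had been tagged for Literature relocation and the relocated copy lost its imports —
here the hypothesis is stated inline, untagged, in Literature vocabulary, exactly as
`BlowupIsLocallyDriven/Negative/BlowupIsLocallyDrivenFalseOfRigidFarStrainBlowup.lean` does).

The crux `HandOverTime` asks for a UNIVERSAL `c > 0` such that, for every `ν > 0` and every classical
Navier–Stokes solution on `ℝ³ × [0,T)` that is Leray–Hopf from a rapidly decaying datum, every HYPERBOLIC
maximum point `x` of `|curl u(t,·)|` (some unit `e` with `|⟪e, Du(t,x) e⟫| > ½‖curl u(t,x)‖`) hands over within
the scale-invariant time `c/‖curl u(t,x)‖`: at some `s ∈ [t, t + c/‖curl u(t,x)‖]` EVERY maximum point of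
`|curl u(s,·)|` is elliptic (`|⟪e, Du(s,x') e⟫| ≤ ½‖curl u(s,x')‖` for all unit `e`).

**The lemma (this file).** If there is ONE viscosity `ν > 0` and ONE global classical solution `(u, p)` —
classical on every `[0,T)`, Leray–Hopf on every `[0,T)` from its rapidly decaying datum `u 0` — such that at
EVERY time `s ≥ 0` SOME maximum point of `|curl u(s,·)|` is hyperbolic (`EternalHyperbolicMaxSolution`), then
`HandOverTime` fails for every `c`: apply it on `[0, T)` with `T := c/‖curl u(0,x₀)‖ + 1` at `t = 0` and the
hyperbolic maximum point `x₀` of time `0`; the hand-over time `s` it returns lies in `[0, c/‖curl u(0,x₀)‖]`,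
where the hypothesis supplies a hyperbolic maximum point — contradiction with "every maximum point at `s` is
elliptic". (Lean's `c / 0 = 0` makes the degenerate case `curl u(0,x₀) = 0` harmless: the window is `{0}`.)

**Why the hypothesis is the right modulus, and why it is not constructible here.** `c` is universal and
`c/‖ω‖_max` is scale-invariant, so an unconditional refutation needs a family of finite-energy smooth flows with
UNBOUNDED dimensionless persistence `S·‖ω(0)‖_max` of a hyperbolic maximum, or one flow with infinite persistence;
the latter is the crisp object. The steady Burgers vortex LAYER `u = (U(z), αy, −αz)` (Beronov–Kida 1996) is a
hyperbolic maximum for EVERY strain rate `α > 0` — at the maximum `M` of `|U'|`,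
`sup_{|e|=1} |⟪e, Du e⟫| = α/2 + ½√(M² + α²) > M/2` — but has infinite energy; a finite-energy eternal example
needs either certified numerics on explicit Schwartz data over a compact time window plus the large-time Stokes
asymptotics of the vorticity maximum, or a perturbative construction around a truncated layer (route docstring
of item 2922, "why it might fail"; refuter kit evidence job j278329 on the item). Neither is in the tree, hence
the `--negative-modulo` lane: NO verdict change on 2922, which stays open (held), and the hypothesis is filed as a
construction item.
-/

noncomputable section

open Set

-- justification: the namespace is fixed by the negative-lemma protocol (`Theorems/<Decl>/Negative/`).
set_option linter.dupNamespace false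

namespace Summit.NavierStokesRegularity.NavierStokesRegularity.Theorems.HandOverTime.Negative

/-! ### The hypothesis -/

/-- **Hypothesis `EternalHyperbolicMaxSolution` (NOT constructible in the tree; filed `--negative-modulo`).**
There are a viscosity `ν > 0` and a global classical solution `(u, p)` of unforced Navier–Stokes on `ℝ³` —
classical on every slab `[0,T)`, Leray–Hopf on every `[0,T)` from its datum `u 0`, the datum rapidly decaying
(exactly the solution class of the crux `HandOverTime`) — such that at every time `s ≥ 0` some maximum point `x`
of `‖curl (u s) ·‖` is HYPERBOLIC: some unit vector `e` has `½‖curl (u s) x‖ < |⟪e, D(u s)(x) e⟫|`. -/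
def EternalHyperbolicMaxSolution : Prop :=
  ∃ (ν : ℝ) (u : ℝ → EuclideanSpace ℝ (Fin 3) → EuclideanSpace ℝ (Fin 3))
    (p : ℝ → EuclideanSpace ℝ (Fin 3) → ℝ), 0 < ν ∧
    Literature.Analysis.FluidPDE.HasRapidSpatialDecay (u 0) ∧
    (∀ T : ℝ, 0 < T →
      Literature.Analysis.FluidPDE.IsClassicalNSSolutionOn (Set.Ico 0 T) ν 0 u p ∧
      Literature.Analysis.FluidPDE.IsLerayHopfOn T ν 0 (u 0) u) ∧
    ∀ s : ℝ, 0 ≤ s → ∃ x : EuclideanSpace ℝ (Fin 3),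
      (∀ y, ‖Literature.Analysis.FluidPDE.curl (u s) y‖ ≤ ‖Literature.Analysis.FluidPDE.curl (u s) x‖) ∧
      ∃ e : EuclideanSpace ℝ (Fin 3), ‖e‖ = 1 ∧
        (1 / 2 : ℝ) * ‖Literature.Analysis.FluidPDE.curl (u s) x‖ < |inner ℝ e (fderiv ℝ (u s) x e)|

/-! ### The negative lemma -/

/-- **`HandOverTime` is false modulo `EternalHyperbolicMaxSolution`.** Given the universal constant `c` of
`HandOverTime`, run it on the eternal solution restricted to `[0, T)`, `T := c/‖curl (u 0) x₀‖ + 1`, at `t = 0`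
and the hyperbolic maximum point `x₀` of time `0`: the returned hand-over time `s ∈ [0, c/‖curl (u 0) x₀‖]` has
all its maximum points elliptic, contradicting the hyperbolic maximum point the hypothesis provides at `s`. -/
theorem handOverTime_false_of_eternalHyperbolicMaxSolution :
    EternalHyperbolicMaxSolution →
      ¬ Summit.NavierStokesRegularity.NavierStokesRegularity.Theses.RossbyDichotomy.HandOverTime := by
  rintro ⟨ν, u, p, hν, hdec, hsol, hhyp⟩ ⟨c, hc, hand⟩
  -- the hyperbolic maximum point at time `0`
  obtain ⟨x₀, hmax₀, e₀, he₀, hhyp₀⟩ := hhyp 0 le_rfl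
  set T : ℝ := c / ‖Literature.Analysis.FluidPDE.curl (u 0) x₀‖ + 1 with hT
  have hwin : 0 ≤ c / ‖Literature.Analysis.FluidPDE.curl (u 0) x₀‖ :=
    div_nonneg hc.le (norm_nonneg _)
  have hTpos : 0 < T := by rw [hT]; linarith
  obtain ⟨hcl, hLH⟩ := hsol T hTpos
  have ht0 : (0 : ℝ) ∈ Set.Ico 0 T := ⟨le_rfl, hTpos⟩
  have hlt : 0 + c / ‖Literature.Analysis.FluidPDE.curl (u 0) x₀‖ < T := by rw [hT]; linarith
  obtain ⟨s, hs, hell⟩ := hand ν T hν hTpos u p hcl hLH hdec 0 ht0 x₀ hmax₀ ⟨e₀, he₀, hhyp₀⟩ hlt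
  -- at the hand-over time `s ≥ 0` the hypothesis gives a hyperbolic maximum point: contradiction
  obtain ⟨x', hmax', e', he', hhyp'⟩ := hhyp s hs.1
  exact absurd (hell x' hmax' e' he') (not_le.mpr hhyp')

/-- Axiom-free sanity form: the implication, stated with the route decl unfolded-by-name only. -/
example : EternalHyperbolicMaxSolution →
    ¬ Summit.NavierStokesRegularity.NavierStokesRegularity.Theses.RossbyDichotomy.HandOverTime :=
  handOverTime_false_of_eternalHyperbolicMaxSolution

end Summit.NavierStokesRegularity.NavierStokesRegularity.Theorems.HandOverTime.Negative
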